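import Mathlib.MeasureTheory.Integral.IntervalIntegral.Basic
import Mathlib.MeasureTheory.Integral.IntervalIntegral.FundThmCalculus
import Mathlib.Tactic.Linarith
import Mathlib.Tactic.Positivity
import Mathlib.Tactic.FieldSimp
import Mathlib.Tactic.Ring
import Mathlib.Tactic.NormNum
import HarnessLib

/-!
# The one-piece mollifier ceiling `Δ/(1+Δ)` (Iwaniec–Sarnak / Kowalski–Michel–VanderKam main term)

Topic `Literature/NumberTheory/LFunctions` (namespace
`Literature.NumberTheory.LFunctions.OnePieceMollifierCeiling`). PROVED, elementary real analysis;
no named facts are introduced (D-0026). Typed for the cell `landau-siegel` (rung F-S3, sub-cell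
§B-fam, support statement S-fam-01 of `B-fam/PLAN.md` v1 §7), as the kernel form of the IN-CLASS
ceiling of the Iwaniec–Sarnak family route at main order — the companion of
`CentralValueFamilyPigeonhole` (the endgame inequality) for the third knife edge of record (the
½-proportion edge).

## What the source prints (held text, read 2026-08-26)

E. Kowalski, P. Michel, J. VanderKam, *Non-vanishing of high derivatives of automorphic
`L`-functions at the center of the critical strip*, J. reine angew. Math. 526 (2000) 1–34
[held: `paper:doi-10-1515-crll-2000-074`; Theorem 6.1 with display (32) on p. 20, (30)–(31) p. 18,
(33) p. 21, footnote 2 p. 7]. For `q` prime, weight 2, harmonic average `Σ^h` over `S₂(q)*`, a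
mollifier of length `M = q̂^Δ` (`q̂ = √q/(2π)`) with coefficients shaped by a profile `P` with
`P(0) = P′(0) = 0`, and a fixed even or odd polynomial `Q` selecting a linear combination of
derivatives of `Λ(f,s)` at `½`, Theorem 6.1 gives, for `0 < Δ < 1`,
`liminf_q Σ^h_{Q̃(Λ(f,s))(½) ≠ 0} 1 ≥ max_{P,Δ} R(P,Q)`, `R(P,Q) = 1/(2(1 + R₂(P,Q)))`,
`R₂(P,Q) = Δ⁻¹ ∬_{[0,1]²} (P″(x)Q(y) − Δ²P(x)Q″(y))² dx dy / (Q(1)P′(1) + ΔQ′(1)P(1))²` (32);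
«Note that we have always `R(P,Q) < ½`» and «one may assume by continuity that `Δ = 1`»
(Remarks, p. 20); for the central VALUE (`Q = 1`, `k = 0`) the choice `P = x²` gives the
proportion `p₀ ≥ ¼` of all forms as `Δ → 1` (footnote 2, p. 7) — i.e. one half of the EVEN forms,
the «fifty percent» of Iwaniec–Sarnak 2000 / Iwaniec, LNM 1891 (2006) §7 [held:
`book:friedlandernd-analytic-number-theory` p0097]. With `Q = 1` the functional reads
`R(P,1) = ½ · (∫₀¹ q)² / ((∫₀¹ q)² + Δ⁻¹ ∫₀¹ q²)` with `q := P″` (`P′(1) = ∫₀¹ P″` since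
`P′(0) = 0`): the factor `½` is the mass of the parity class, and the second factor is the
proportion WITHIN the parity class in the Iwaniec–Sarnak normalisation (profile `p = P′`,
`p(0) = 0`, `𝔭 = p(1)²/(p(1)² + Δ⁻¹∫₀¹ p′²)`).

## What is typed here

The class of ALL one-piece profiles at main order is parametrised by the profile derivative
`q = p′ ∈ L²(0,1)` (so `p(t) = ∫₀ᵗ q`, `p(0) = 0`, `p(1) = ∫₀¹ q` — this is exactly the absolutely
continuous / `H¹` closure of the smooth profiles; no smoothness is assumed), and

* `propIS Δ q := (∫₀¹ q)² / ((∫₀¹ q)² + Δ⁻¹ ∫₀¹ q²)` — the within-parity-class proportion functional;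
* `sq_integral_le_integral_sq` : `(∫₀¹ q)² ≤ ∫₀¹ q²` (Cauchy–Schwarz on the unit interval, from
  `0 ≤ ∫₀¹ (q − ∫₀¹ q)²`), for every interval-integrable `q` with `q²` interval-integrable;
* `propIS_le` : `0 < Δ ⇒ propIS Δ q ≤ Δ/(1+Δ)` for every such `q` — THE CEILING;
* `propIS_const` : the constant profile derivative `q ≡ c ≠ 0` (`p(t) = ct`, KMV's `P = x²`)
  attains `Δ/(1+Δ)` — the supremum over the class is a maximum and equals `Δ/(1+Δ)`;
* `propIS_le_half`, `propIS_lt_half` : for `0 < Δ ≤ 1` the proportion is `≤ ½`, and `< ½` when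
  `Δ < 1` — at main order the one-piece class reaches the knife edge `½` only at the END `Δ = 1`
  of the printed range `0 < Δ < 1` and never crosses it;
* `half_propIS_le` : the all-forms (KMV) scale, `½ · propIS Δ q ≤ Δ/(2(1+Δ))`;
* `propIS_deriv_le` : the same ceiling stated for a profile `p` with `p(0) = 0` that is
  differentiable on `[0,1]` with interval-integrable `p′` and `p′²` (via the fundamental theorem
  of calculus `p(1) = ∫₀¹ p′`).

These are the certificates behind the «C0 / C0⁺ (profile closure)» rows of the cell's
`B-fam/DESIGN-MAP-fam.md` (numerics of record: kit j256254 / j256822, exact-rational pencil optima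
`= Δ/(1+Δ)` at `Δ = k/20`). WHAT THIS IS NOT: no statement that `propIS` IS the harmonic
proportion of non-vanishing (that is KMV Theorem 6.1 / Props 4.1, 5.1 — the cell's input famE-01,
typed elsewhere), nothing about mollifiers longer than the diagonal range (`Δ > 1`), about
coefficients not of profile type, or about Landau–Siegel zeros.

## References

* [KowalskiMichelVanderKam2000] Thm 6.1 (32) p. 20, Remarks p. 20, footnote 2 p. 7 (held).
* [IwaniecConversations2006] §7 p. 97 («50 %»; held chunks p0095–p0097).
* [IwaniecSarnak2000] Israel J. Math. 120, 155–177 (primary; not held, acquisition acq-11417).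
* [BalkanovaFrolenkov2021] §8.4 (proof of Thm 8.7: «≥ Δ/(1+Δ)»; Lemma 8.6), held `paper:arxiv-1610.03465` p0021.
* [Rudin1987] Thm 3.5 (Hölder/Schwarz inequality) — the Cauchy–Schwarz step.
-/

namespace Literature.NumberTheory.LFunctions.OnePieceMollifierCeiling

open MeasureTheory Set intervalIntegral

/-- The Iwaniec–Sarnak one-piece proportion functional at main order, WITHIN the parity class,
as a function of the mollifier length ratio `Δ` and of the profile derivative `q = p′` on `[0,1]`
(`p(0) = 0`, so `p(1) = ∫₀¹ q`): `𝔭 = (∫₀¹ q)² / ((∫₀¹ q)² + Δ⁻¹ ∫₀¹ q²)`.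
In KMV's normalisation (`q = P″`, [KowalskiMichelVanderKam2000] (32) with `Q = 1`) the all-forms
proportion is `½ · propIS Δ P″`. Lean's `x / 0 = 0` makes the degenerate profile `q = 0` a.e.
evaluate to `0`, the correct proportion for the zero mollifier.
[cite: KowalskiMichelVanderKam2000, Thm 6.1 (32) with Q = 1, p. 20 (within-parity-class normalisation)] -/
noncomputable def propIS (Δ : ℝ) (q : ℝ → ℝ) : ℝ :=
  (∫ x in (0:ℝ)..1, q x) ^ 2 / ((∫ x in (0:ℝ)..1, q x) ^ 2 + Δ⁻¹ * ∫ x in (0:ℝ)..1, q x ^ 2)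

/-- **Cauchy–Schwarz on the unit interval**: `(∫₀¹ q)² ≤ ∫₀¹ q²` for every interval-integrable
`q : ℝ → ℝ` with `q²` interval-integrable — proved from `0 ≤ ∫₀¹ (q − c)²` with `c = ∫₀¹ q`.
In profile language (`p′ = q`, `p(0) = 0`): `p(1)² ≤ ∫₀¹ p′²`, «the whole content» of the
one-piece ceiling (B-fam/PLAN.md v1 §4 O2).
[cite: Rudin1987, Thm 3.5 (Schwarz inequality, p = q = 2, on ([0,1], dx) with g = 1)] -/
theorem sq_integral_le_integral_sq (q : ℝ → ℝ) (hq : IntervalIntegrable q volume 0 1)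
    (hq2 : IntervalIntegrable (fun x => q x ^ 2) volume 0 1) :
    (∫ x in (0:ℝ)..1, q x) ^ 2 ≤ ∫ x in (0:ℝ)..1, q x ^ 2 := by
  set c : ℝ := ∫ x in (0:ℝ)..1, q x with hc
  have hcq : IntervalIntegrable (fun x => (2 * c) * q x) volume 0 1 := hq.const_mul (2 * c)
  have hcc : IntervalIntegrable (fun _ : ℝ => c ^ 2) volume 0 1 := intervalIntegrable_const
  have h0 : 0 ≤ ∫ x in (0:ℝ)..1, (q x - c) ^ 2 :=
    intervalIntegral.integral_nonneg zero_le_one (fun _ _ => sq_nonneg _)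
  have hfun : (fun x => (q x - c) ^ 2) = fun x => (q x ^ 2 - (2 * c) * q x) + c ^ 2 := by
    funext x; ring
  have hexp : ∫ x in (0:ℝ)..1, (q x - c) ^ 2 = (∫ x in (0:ℝ)..1, q x ^ 2) - c ^ 2 := by
    rw [hfun, intervalIntegral.integral_add (hq2.sub hcq) hcc,
      intervalIntegral.integral_sub hq2 hcq, intervalIntegral.integral_const_mul,
      intervalIntegral.integral_const]
    simp only [sub_zero, smul_eq_mul, one_mul]
    ring
  linarith

/-- Non-negativity of the denominator piece `0 ≤ ∫₀¹ q²` (plumbing). [folklore] -/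
private theorem integral_sq_nonneg (q : ℝ → ℝ) : 0 ≤ ∫ x in (0:ℝ)..1, q x ^ 2 :=
  intervalIntegral.integral_nonneg zero_le_one (fun _ _ => sq_nonneg _)

/-- `propIS` is a proportion: `0 ≤ propIS Δ q` for `0 < Δ` (no integrability needed).
[cite: KowalskiMichelVanderKam2000, Thm 6.1 (32), p. 20 (R(P,Q) ≥ 0)] -/
theorem propIS_nonneg (Δ : ℝ) (hΔ : 0 < Δ) (q : ℝ → ℝ) : 0 ≤ propIS Δ q := by
  unfold propIS
  have h1 : 0 ≤ (∫ x in (0:ℝ)..1, q x) ^ 2 := sq_nonneg _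
  have h2 : 0 ≤ Δ⁻¹ * ∫ x in (0:ℝ)..1, q x ^ 2 :=
    mul_nonneg (le_of_lt (inv_pos.mpr hΔ)) (integral_sq_nonneg q)
  positivity

/-- **THE ONE-PIECE CEILING (S-fam-01).** For every mollifier length ratio `Δ > 0` and every
profile derivative `q` (interval-integrable with `q²` interval-integrable — the `H¹` closure of the
smooth profiles with `p(0) = 0`), the within-parity-class proportion at main order satisfies
`propIS Δ q ≤ Δ/(1+Δ)`. Proof: with `a = (∫₀¹ q)²`, `b = ∫₀¹ q²`, Cauchy–Schwarz gives `a ≤ b`,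
and `a/(a + b/Δ) ≤ Δ/(1+Δ) ⟺ a ≤ b`. The law `Δ/(1+Δ)` is the one printed for the harmonic
family `H_{2k}(1)` in [BalkanovaFrolenkov2021] §8.4 («`≥ (M₁ − M̃₁)²/M₂ ≥ Δ/(1+Δ)`», second
mollified moment `∝ (1 + 1/Δ)`, Lemma 8.6) and, at `Δ → 1`, KMV's `p₀ ≥ ¼` of all forms.
[cite: KowalskiMichelVanderKam2000, Thm 6.1 (32) with Q = 1 and footnote 2 p. 7 (k = 0 envelope)]
[cite: BalkanovaFrolenkov2021, §8.4 proof of Theorem 8.7 and Lemma 8.6 (law Δ/(1+Δ))] -/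
theorem propIS_le (Δ : ℝ) (hΔ : 0 < Δ) (q : ℝ → ℝ) (hq : IntervalIntegrable q volume 0 1)
    (hq2 : IntervalIntegrable (fun x => q x ^ 2) volume 0 1) :
    propIS Δ q ≤ Δ / (1 + Δ) := by
  unfold propIS
  set a : ℝ := (∫ x in (0:ℝ)..1, q x) ^ 2 with ha
  set b : ℝ := ∫ x in (0:ℝ)..1, q x ^ 2 with hb
  have hab : a ≤ b := sq_integral_le_integral_sq q hq hq2
  have ha0 : 0 ≤ a := sq_nonneg _
  have hb0 : 0 ≤ b := integral_sq_nonneg q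
  have hΔ1 : 0 < 1 + Δ := by linarith
  have hbound : 0 ≤ Δ / (1 + Δ) := div_nonneg hΔ.le hΔ1.le
  by_cases hD : a + Δ⁻¹ * b = 0
  · rw [hD, div_zero]; exact hbound
  · have hDpos : 0 < a + Δ⁻¹ * b := by
      have : 0 ≤ a + Δ⁻¹ * b := add_nonneg ha0 (mul_nonneg (le_of_lt (inv_pos.mpr hΔ)) hb0)
      exact lt_of_le_of_ne this (Ne.symm hD)
    rw [div_le_div_iff₀ hDpos hΔ1]
    -- goal: a * (1 + Δ) ≤ Δ * (a + Δ⁻¹ * b)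
    have hΔne : Δ ≠ 0 := ne_of_gt hΔ
    have : Δ * (a + Δ⁻¹ * b) = Δ * a + b := by
      field_simp
    rw [this]
    nlinarith

/-- **The ceiling is attained**: the constant profile derivative `q ≡ c ≠ 0` (profile `p(t) = ct`;
KMV's `P = x²` up to scaling, footnote 2 p. 7) gives exactly `Δ/(1+Δ)`. Hence
`sup_q propIS Δ q = max = Δ/(1+Δ)` (`½` of the even forms at `Δ = 1`, `¼` of all forms).
[cite: KowalskiMichelVanderKam2000, footnote 2 p. 7 (P = x² gives p₀ ≥ ¼ as Δ → 1)] -/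
theorem propIS_const (Δ : ℝ) (hΔ : 0 < Δ) (c : ℝ) (hc : c ≠ 0) :
    propIS Δ (fun _ => c) = Δ / (1 + Δ) := by
  unfold propIS
  simp only [intervalIntegral.integral_const, sub_zero, smul_eq_mul, one_mul]
  have hΔne : Δ ≠ 0 := ne_of_gt hΔ
  have hc2 : c ^ 2 ≠ 0 := pow_ne_zero 2 hc
  have hΔ1 : 1 + Δ ≠ 0 := by
    have : 0 < 1 + Δ := by linarith
    exact ne_of_gt this
  field_simp
  ring

/-- **The knife-edge point**: at the end `Δ = 1` of the printed range (mollifier of length `q̂`,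
KMV Remark p. 20 «one may assume by continuity that `Δ = 1`») the linear profile gives EXACTLY
one half of the parity class — Iwaniec–Sarnak's «fifty percent» at main order.
[cite: IwaniecConversations2006, §7 p. 97 («at least 50 %»)] [cite: KowalskiMichelVanderKam2000, footnote 2 p. 7] -/
theorem propIS_one_const (c : ℝ) (hc : c ≠ 0) : propIS 1 (fun _ => c) = 1 / 2 := by
  rw [propIS_const 1 one_pos c hc]
  norm_num

/-- **Knife edge, weak form**: inside the printed range `0 < Δ ≤ 1` no one-piece profile exceeds
one half of the parity class at main order: `propIS Δ q ≤ ½`.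
[cite: KowalskiMichelVanderKam2000, Remark p. 20 («always R(P,Q) < ½») with Thm 6.1, Q = 1] -/
theorem propIS_le_half (Δ : ℝ) (hΔ : 0 < Δ) (hΔ1 : Δ ≤ 1) (q : ℝ → ℝ)
    (hq : IntervalIntegrable q volume 0 1) (hq2 : IntervalIntegrable (fun x => q x ^ 2) volume 0 1) :
    propIS Δ q ≤ 1 / 2 := by
  have h := propIS_le Δ hΔ q hq hq2
  have hle : Δ / (1 + Δ) ≤ 1 / 2 := by
    rw [div_le_div_iff₀ (by linarith) (by norm_num)]
    linarith
  exact h.trans hle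

/-- **Knife edge, strict form**: for `0 < Δ < 1` (the open range of KMV Props 4.1/5.1) every
one-piece profile stays STRICTLY below one half of the parity class: `propIS Δ q < ½`.
The edge `½` is reached only in the limit `Δ → 1` (`propIS_const` with `Δ = 1`).
[cite: KowalskiMichelVanderKam2000, Thm 6.1 (range 0 < Δ < 1) and Remark p. 20] -/
theorem propIS_lt_half (Δ : ℝ) (hΔ : 0 < Δ) (hΔ1 : Δ < 1) (q : ℝ → ℝ)
    (hq : IntervalIntegrable q volume 0 1) (hq2 : IntervalIntegrable (fun x => q x ^ 2) volume 0 1) :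
    propIS Δ q < 1 / 2 := by
  have h := propIS_le Δ hΔ q hq hq2
  have hlt : Δ / (1 + Δ) < 1 / 2 := by
    rw [div_lt_div_iff₀ (by linarith) (by norm_num)]
    linarith
  exact lt_of_le_of_lt h hlt

/-- **All-forms scale** (KMV / Balkanova–Frolenkov «c»-normalisation: half the forms lie in the
parity class): `½ · propIS Δ q ≤ Δ/(2(1+Δ))`, i.e. KMV's `R(P,1) ≤ Δ/(2(1+Δ))` (`= ¼` at `Δ = 1`,
footnote 2 p. 7: `p₀ ≥ ¼`).
[cite: KowalskiMichelVanderKam2000, footnote 2 p. 7 (p₀ ≥ ¼) with Thm 6.1 (32)] -/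
theorem half_propIS_le (Δ : ℝ) (hΔ : 0 < Δ) (q : ℝ → ℝ) (hq : IntervalIntegrable q volume 0 1)
    (hq2 : IntervalIntegrable (fun x => q x ^ 2) volume 0 1) :
    (1 / 2) * propIS Δ q ≤ Δ / (2 * (1 + Δ)) := by
  have h := propIS_le Δ hΔ q hq hq2
  have hΔ1 : 0 < 1 + Δ := by linarith
  have : Δ / (2 * (1 + Δ)) = (1 / 2) * (Δ / (1 + Δ)) := by
    field_simp
  rw [this]
  exact mul_le_mul_of_nonneg_left h (by norm_num)

/-- **The ceiling in profile language** (Iwaniec–Sarnak normalisation). For a profile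
`p : ℝ → ℝ` with `p(0) = 0`, differentiable at every point of `[0,1]` with derivative `p′`
interval-integrable together with `p′²` (e.g. `p ∈ C¹[0,1]`, or any polynomial), the main-order
proportion `p(1)²/(p(1)² + Δ⁻¹∫₀¹ p′²)` is at most `Δ/(1+Δ)` (`0 < Δ`).
[cite: BalkanovaFrolenkov2021, §8.4 proof of Theorem 8.7 (law Δ/(1+Δ))] [cite: KowalskiMichelVanderKam2000, Thm 6.1 (32), Q = 1] -/
theorem propIS_deriv_le (Δ : ℝ) (hΔ : 0 < Δ) (p p' : ℝ → ℝ) (hp0 : p 0 = 0)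
    (hderiv : ∀ x ∈ uIcc (0:ℝ) 1, HasDerivAt p (p' x) x)
    (hp' : IntervalIntegrable p' volume 0 1)
    (hp'2 : IntervalIntegrable (fun x => p' x ^ 2) volume 0 1) :
    (p 1) ^ 2 / ((p 1) ^ 2 + Δ⁻¹ * ∫ x in (0:ℝ)..1, p' x ^ 2) ≤ Δ / (1 + Δ) := by
  have hftc : ∫ x in (0:ℝ)..1, p' x = p 1 - p 0 :=
    intervalIntegral.integral_eq_sub_of_hasDerivAt hderiv hp'
  have hp1 : p 1 = ∫ x in (0:ℝ)..1, p' x := by rw [hftc, hp0, sub_zero]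
  have h := propIS_le Δ hΔ p' hp' hp'2
  unfold propIS at h
  rw [hp1]
  exact h

/-- **Continuous profile derivatives are admissible**: for `q` continuous on `[0,1]` both
integrability hypotheses of `propIS_le` hold, so `propIS Δ q ≤ Δ/(1+Δ)` with no further
side condition (covers every polynomial / smooth / piecewise-`C¹`-glued-continuously profile).
[cite: KowalskiMichelVanderKam2000, Thm 6.1 (32), Q = 1 (P ranges over smooth profiles)] -/
theorem propIS_le_of_continuousOn (Δ : ℝ) (hΔ : 0 < Δ) (q : ℝ → ℝ)
    (hq : ContinuousOn q (uIcc (0:ℝ) 1)) : propIS Δ q ≤ Δ / (1 + Δ) := by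
  have h1 : IntervalIntegrable q volume 0 1 := hq.intervalIntegrable
  have h2 : IntervalIntegrable (fun x => q x ^ 2) volume 0 1 := by
    have : ContinuousOn (fun x => q x ^ 2) (uIcc (0:ℝ) 1) := hq.pow 2
    exact this.intervalIntegrable
  exact propIS_le Δ hΔ q h1 h2

/-! ## Uniqueness of the maximiser among continuous profile derivatives (appended 2026-08-26)

For the cell's KILL text («attained ONLY by `P₀ = x²`»): among CONTINUOUS profile derivatives `q`
on `[0,1]` the ceiling `Δ/(1+Δ)` is reached only by the constant ones (`p` linear, KMV's `P = x²`
up to scaling); any non-constant continuous `q` is STRICTLY below the ceiling. (In the full `L²`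
closure the same holds with «constant almost everywhere»; not typed.) -/

/-- **Strict ceiling for non-constant continuous profile derivatives**: if `q` is continuous on
`[0,1]` and takes, somewhere on `[0,1]`, a value different from its mean `∫₀¹ q`, then
`propIS Δ q < Δ/(1+Δ)`. Proof: `∫₀¹ (q − ∫₀¹q)² > 0` by continuity, i.e. Cauchy–Schwarz is strict.
[cite: KowalskiMichelVanderKam2000, footnote 2 p. 7 and §7 p. 20 (the optimal P₀ = x² for k = 0) (derivation: strictness off the optimum)] -/
theorem propIS_lt_of_exists_ne_mean (Δ : ℝ) (hΔ : 0 < Δ) (q : ℝ → ℝ)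
    (hq : ContinuousOn q (Icc (0:ℝ) 1))
    (hne : ∃ x ∈ Icc (0:ℝ) 1, q x ≠ ∫ t in (0:ℝ)..1, q t) :
    propIS Δ q < Δ / (1 + Δ) := by
  set c : ℝ := ∫ t in (0:ℝ)..1, q t with hc
  have hq' : ContinuousOn q (uIcc (0:ℝ) 1) := by rwa [uIcc_of_le zero_le_one]
  have hqi : IntervalIntegrable q volume 0 1 := hq'.intervalIntegrable
  have hq2i : IntervalIntegrable (fun x => q x ^ 2) volume 0 1 := (hq'.pow 2).intervalIntegrable
  -- strict positivity of ∫ (q - c)^2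
  have hgc : ContinuousOn (fun x => (q x - c) ^ 2) (Icc (0:ℝ) 1) := (hq.sub continuousOn_const).pow 2
  have hlt : (∫ x in (0:ℝ)..1, (0:ℝ)) < ∫ x in (0:ℝ)..1, (q x - c) ^ 2 := by
    apply intervalIntegral.integral_lt_integral_of_continuousOn_of_le_of_exists_lt zero_lt_one
      continuousOn_const hgc
    · intro x _; exact sq_nonneg _
    · obtain ⟨x, hx, hqx⟩ := hne
      refine ⟨x, hx, ?_⟩
      have : q x - c ≠ 0 := sub_ne_zero.mpr hqx
      positivity
  have hzero : (∫ x in (0:ℝ)..1, (0:ℝ)) = 0 := by simp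
  -- expand ∫ (q - c)^2 = ∫ q^2 - c^2 (as in sq_integral_le_integral_sq)
  have hcq : IntervalIntegrable (fun x => (2 * c) * q x) volume 0 1 := hqi.const_mul (2 * c)
  have hcc : IntervalIntegrable (fun _ : ℝ => c ^ 2) volume 0 1 := intervalIntegrable_const
  have hfun : (fun x => (q x - c) ^ 2) = fun x => (q x ^ 2 - (2 * c) * q x) + c ^ 2 := by
    funext x; ring
  have hexp : ∫ x in (0:ℝ)..1, (q x - c) ^ 2 = (∫ x in (0:ℝ)..1, q x ^ 2) - c ^ 2 := by
    rw [hfun, intervalIntegral.integral_add (hq2i.sub hcq) hcc,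
      intervalIntegral.integral_sub hq2i hcq, intervalIntegral.integral_const_mul,
      intervalIntegral.integral_const]
    simp only [sub_zero, smul_eq_mul, one_mul]
    ring
  have hab : c ^ 2 < ∫ x in (0:ℝ)..1, q x ^ 2 := by
    rw [hzero, hexp] at hlt; linarith
  -- now the algebra: a < b ⇒ a/(a + b/Δ) < Δ/(1+Δ)
  unfold propIS
  rw [← hc]
  set b : ℝ := ∫ x in (0:ℝ)..1, q x ^ 2 with hb
  have hb0 : 0 < b := lt_of_le_of_lt (sq_nonneg c) hab
  have hΔ1 : 0 < 1 + Δ := by linarith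
  have hD : 0 < c ^ 2 + Δ⁻¹ * b := by
    have : 0 < Δ⁻¹ * b := mul_pos (inv_pos.mpr hΔ) hb0
    positivity
  rw [div_lt_div_iff₀ hD hΔ1]
  have hΔne : Δ ≠ 0 := ne_of_gt hΔ
  have : Δ * (c ^ 2 + Δ⁻¹ * b) = Δ * c ^ 2 + b := by field_simp
  rw [this]
  nlinarith

/-- **The maximiser is unique (continuous class)**: if a continuous profile derivative `q`
reaches the ceiling, `propIS Δ q = Δ/(1+Δ)`, then `q` is constant on `[0,1]` (equal to its mean):
the one-piece optimum `P₀ = x²` of KMV (footnote 2, §7) is the ONLY maximiser up to scaling.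
[cite: KowalskiMichelVanderKam2000, footnote 2 p. 7 and §7 p. 20 (optimal P₀ = x²) (derivation: uniqueness)] -/
theorem eq_mean_of_propIS_eq_ceiling (Δ : ℝ) (hΔ : 0 < Δ) (q : ℝ → ℝ)
    (hq : ContinuousOn q (Icc (0:ℝ) 1)) (hmax : propIS Δ q = Δ / (1 + Δ)) :
    ∀ x ∈ Icc (0:ℝ) 1, q x = ∫ t in (0:ℝ)..1, q t := by
  by_contra h
  push Not at h
  have hlt := propIS_lt_of_exists_ne_mean Δ hΔ q hq h
  rw [hmax] at hlt
  exact lt_irrefl _ hlt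

end Literature.NumberTheory.LFunctions.OnePieceMollifierCeiling
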